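import Summits.Ventures.PercRepro.S2NineCaps

/-!
# PercRepro — S2: THE CIRCUIT CAPS AT CORANK `11` — THE CELLS `(13, 11)`, `(12, 11)` AND `(11, 11)` (p7, gen 19; sub-claim S2; the row `p = 13`)

The caps the cells of corank `11` feed to the kit: on the coloop-free `e`-free core of rank `13` on `24` points `s₃ ≤ 24` (`TriangleCap.cq3 11`),
`s₄ ≤ 225 = ⌊24·188/20⌋` (the averaging recursion on `avgChain16 10 = 188`), `s₅ ≤ 1917 = ⌊24·1518/19⌋`
(on `avgChain5b 10 = 1518`) — **`caps_thirteen_eleven_cf`**; on the scaled coloop-free cell `(12, 11)` (`23` points) `24 / 227 / 1939` —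
**`caps_twelve_eleven_cf`**; on the twice-scaled cell `(11, 11)` (`22` points, coloops allowed) the plain nullity-`11` caps `24 / 250 / 2208`
(`avgChain16 11`, `avgChain5b 11`) — **`caps_eleven_eleven`**. Nothing about any cell is claimed. Axioms: standard.
-/

open scoped Matroid

namespace PercRepro

namespace ThmN

open Set

variable {α : Type}

/-- The coloop-free caps at `(13, 11)`: `s₃ ≤ 24`, `s₄ ≤ 225` (`⌊24·188/20⌋` on `avgChain16 10`), `s₅ ≤ 1917` (`⌊24·1518/19⌋`). -/
theorem caps_thirteen_eleven_cf (M : Matroid α) [M.Finite]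
    (hd : M.E.encard = M.eRank + ((11 : ℕ) : ℕ∞)) (hn : M.E.ncard = 13 + 11)
    (hfree : ∀ e ∈ M.E, ∃ A ⊆ M.E \ {e}, e ∉ M.closure A ∧ e ∉ M.closure ((M.E \ {e}) \ A)) (hK : ∀ e, ¬ M.IsColoop e) :
    {C : Set α | M.IsCircuit C ∧ C.ncard = 3}.ncard ≤ 24 ∧
      {C : Set α | M.IsCircuit C ∧ C.ncard = 4}.ncard ≤ 225 ∧
        {C : Set α | M.IsCircuit C ∧ C.ncard = 5}.ncard ≤ 1917 := by
  have hs3 := TriangleCap.core_ncard_triangles_le_cq3 M hfree hd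
  rw [show TriangleCap.cq3 11 = 24 by decide] at hs3
  have hcol : M.coloops = ∅ := S2.coloops_eq_empty_of_forall_not M hK
  have hm : 24 ≤ (M.E \ M.coloops).ncard := by
    rw [hcol, Set.sdiff_empty, hn]
  have hd' : M.E.encard = M.eRank + (((10 : ℕ) : ℕ∞) + 1) := by
    rw [hd]; norm_num
  have h := S1.ncard_fourCircuits_sub_div_le_of_nonColoops M hfree hd' (by norm_num) hm (B := 188)
    (fun M' _ hfree' hd'' => by
      have h := ncard_fourCircuits_le_avgChain16 10 M' hfree' hd''
      rw [show avgChain16 10 = 188 by decide] at h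
      exact h)
  have hs4 : {C : Set α | M.IsCircuit C ∧ C.ncard = 4}.ncard ≤ 225 := by
    have := S1.le_mul_div_of_sub_div_le (by norm_num : 4 < 24) h
    omega
  have hs5 := S2.ncard_fiveCircuits_le_of_no_coloop M hfree hd' hK (by omega)
  rw [hn] at hs5
  have h5 : (13 + 11) * S1.avgChain5b 10 / (13 + 11 - 5) = 1917 := by
    rw [show S1.avgChain5b 10 = 1518 by decide]
  rw [h5] at hs5
  exact ⟨hs3, hs4, hs5⟩

/-- The coloop-free caps at `(12, 11)`: `s₃ ≤ 24`, `s₄ ≤ 227` (`⌊23·188/19⌋` on `avgChain16 10`), `s₅ ≤ 1939` (`⌊23·1518/18⌋`). -/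
theorem caps_twelve_eleven_cf (M : Matroid α) [M.Finite]
    (hd : M.E.encard = M.eRank + ((11 : ℕ) : ℕ∞)) (hn : M.E.ncard = 12 + 11)
    (hfree : ∀ e ∈ M.E, ∃ A ⊆ M.E \ {e}, e ∉ M.closure A ∧ e ∉ M.closure ((M.E \ {e}) \ A)) (hK : ∀ e, ¬ M.IsColoop e) :
    {C : Set α | M.IsCircuit C ∧ C.ncard = 3}.ncard ≤ 24 ∧
      {C : Set α | M.IsCircuit C ∧ C.ncard = 4}.ncard ≤ 227 ∧
        {C : Set α | M.IsCircuit C ∧ C.ncard = 5}.ncard ≤ 1939 := by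
  have hs3 := TriangleCap.core_ncard_triangles_le_cq3 M hfree hd
  rw [show TriangleCap.cq3 11 = 24 by decide] at hs3
  have hcol : M.coloops = ∅ := S2.coloops_eq_empty_of_forall_not M hK
  have hm : 23 ≤ (M.E \ M.coloops).ncard := by
    rw [hcol, Set.sdiff_empty, hn]
  have hd' : M.E.encard = M.eRank + (((10 : ℕ) : ℕ∞) + 1) := by
    rw [hd]; norm_num
  have h := S1.ncard_fourCircuits_sub_div_le_of_nonColoops M hfree hd' (by norm_num) hm (B := 188)
    (fun M' _ hfree' hd'' => by
      have h := ncard_fourCircuits_le_avgChain16 10 M' hfree' hd''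
      rw [show avgChain16 10 = 188 by decide] at h
      exact h)
  have hs4 : {C : Set α | M.IsCircuit C ∧ C.ncard = 4}.ncard ≤ 227 := by
    have := S1.le_mul_div_of_sub_div_le (by norm_num : 4 < 23) h
    omega
  have hs5 := S2.ncard_fiveCircuits_le_of_no_coloop M hfree hd' hK (by omega)
  rw [hn] at hs5
  have h5 : (12 + 11) * S1.avgChain5b 10 / (12 + 11 - 5) = 1939 := by
    rw [show S1.avgChain5b 10 = 1518 by decide]
  rw [h5] at hs5
  exact ⟨hs3, hs4, hs5⟩

/-- The caps at `(11, 11)` (coloops allowed): `s₃ ≤ 24`, `s₄ ≤ 250 = avgChain16 11`, `s₅ ≤ 2208 = avgChain5b 11`. -/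
theorem caps_eleven_eleven (M : Matroid α) [M.Finite]
    (hd : M.E.encard = M.eRank + ((11 : ℕ) : ℕ∞))
    (hfree : ∀ e ∈ M.E, ∃ A ⊆ M.E \ {e}, e ∉ M.closure A ∧ e ∉ M.closure ((M.E \ {e}) \ A)) :
    {C : Set α | M.IsCircuit C ∧ C.ncard = 3}.ncard ≤ 24 ∧
      {C : Set α | M.IsCircuit C ∧ C.ncard = 4}.ncard ≤ 250 ∧
        {C : Set α | M.IsCircuit C ∧ C.ncard = 5}.ncard ≤ 2208 := by
  have hs3 := TriangleCap.core_ncard_triangles_le_cq3 M hfree hd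
  rw [show TriangleCap.cq3 11 = 24 by decide] at hs3
  have hs4 := ncard_fourCircuits_le_avgChain16 11 M hfree hd
  rw [show avgChain16 11 = 250 by decide] at hs4
  have hs5 := S1.ncard_fiveCircuits_le_avgChain5b 11 M hfree hd
  rw [show S1.avgChain5b 11 = 2208 by decide] at hs5
  exact ⟨hs3, hs4, hs5⟩

end ThmN

end PercRepro
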